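import Mathlib
import Summits.ResolutionOfSingularities.ResolutionOfSingularities.Theorems.RadicialJungCleanModelsCleanLU2Extraction
import Summits.ResolutionOfSingularities.ResolutionOfSingularities.Theorems.RadicialJungCleanModelsT2CleanModelsDimLETwoOverField
import Summits.ResolutionOfSingularities.ResolutionOfSingularities.Theorems.RadicialJungCleanModelsStubStacks0BICLocus
import Summits.ResolutionOfSingularities.ResolutionOfSingularities.Theorems.RadicialJungCleanModelsCleanRegTransport
import Summits.ResolutionOfSingularities.ResolutionOfSingularities.Theorems.RadicialJungCleanModelsCleanLU3ArcPackage
import Summits.ResolutionOfSingularities.ResolutionOfSingularities.Theorems.RadicialJungCleanModelsL1AdjoinRoot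
import Literature.AlgebraicGeometry.Resolution.ProjectiveSpaceRegular
import HarnessLib

/-!
# Route `RadicialJung`, crux `CleanModels` (stmt-15917), stub `stub_cleanLU3DefectNonDiscrete`, sub-line (C-div), stub D2:
# CLEAN LOCAL UNIFORMIZATION IN DIMENSION TWO from a regular affine model (Steps 5–9 of `stub_cleanLU2`)

Lead `res-B-lead-1` g5.  OURS; nothing here proves resolution in characteristic `p`.

* `isLocalBlowup_locAtCentre_adjoin` — `(A₁[t₀])_{𝔪_O} ` is a local blowing up of `(A₁)_{𝔪_O}`;
* `looseCleanForm_of_pointClause` — the pointwise clause of ✓ `cleanModels_dimLETwo_of_f75c` as `LooseCleanForm` at the stalk;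
* `cleanRegAt_of_regularAffineModel` — for a finitely generated regular `k`-subalgebra `A₁ ⊆ Ō` of `κ = Frac A₁` of dimension `≤ 2` and
  `ū ∉ κ^p`, some finitely generated `Ā' ⊇ A₁` inside `Ō` is clean-regular at the centre of `Ō` for the `κ^p`-line of `ū`:
  ✓ `cleanModels_dimLETwo_of_f75c` (F-75c = ✓ `stub_stacks0BICLocus`) on `W = Spec A₁` with `L = K(W)(ū^{1/p})` (`AdjoinRoot`, purely
  inseparable of degree `p`), ✓ `exists_model_of_proper_birational` (centre of `Ō` on the clean model, extraction, `δ`, `Θ`), the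
  coefficients of `y ∈ L ∖ K(W)` in the power basis, and transport (`LooseCleanForm.map Θ`, `.of_ringEquiv δ`, ✓ `exists_model_of_isLocalBlowup`);
* `cleanLU2_of_regularAffineModel` — the same with `CleanRegAt` unfolded to the workfile's three-form disjunction.
-/

noncomputable section

set_option linter.dupNamespace false -- mandated namespace of this single-conjunct summit

open IsLocalRing AlgebraicGeometry CategoryTheory
open Literature.AlgebraicGeometry.Resolution Literature.AlgebraicGeometry.Motives

namespace Summit.ResolutionOfSingularities.ResolutionOfSingularities.Theorems.RadicialJung.CleanModels

section CleanLU2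

open Polynomial

variable {k : Type} [Field k] {κ : Type} [Field κ] [Algebra k κ]

/-- `locAtCentre (A₁[t₀])_𝔪 O` is a local blowing up of `locAtCentre A₁ O` (finitely many new elements of `O`). [folklore] -/
theorem isLocalBlowup_locAtCentre_adjoin (O : ValuationSubring κ) (A₁ : Subalgebra k κ) (hA₁O : A₁.toSubring ≤ O.toSubring)
    (T : Subalgebra A₁ κ) (hTO : T.toSubring ≤ O.toSubring) (hTfg : T.FG) :
    IsLocalBlowup O (locAtCentre A₁.toSubring O) (locAtCentre T.toSubring O) := by
  classical
  obtain ⟨t₀, ht₀⟩ := hTfg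
  have hA₁T : A₁.toSubring ≤ T.toSubring := fun z hz => by
    have : algebraMap A₁ κ ⟨z, hz⟩ ∈ T := T.algebraMap_mem _
    exact this
  have ht₀T : (↑t₀ : Set κ) ⊆ T := by rw [← ht₀]; exact Algebra.subset_adjoin
  refine ⟨locAtCentre_le hA₁O, t₀, fun z hz => hTO (ht₀T hz), ?_⟩
  set C := Subring.closure ((locAtCentre A₁.toSubring O : Set κ) ∪ ↑t₀) with hC
  have hTC : T.toSubring ≤ C := by
    rw [← ht₀]
    let C' : Subalgebra A₁ κ :=
      { C with algebraMap_mem' := fun a => Subring.subset_closure (Or.inl (le_locAtCentre _ O a.2)) }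
    have : Algebra.adjoin (↥A₁) (↑t₀ : Set κ) ≤ C' := Algebra.adjoin_le fun w hw => Subring.subset_closure (Or.inr hw)
    exact fun z hz => this hz
  have hCT : C ≤ locAtCentre T.toSubring O := by
    rw [hC, Subring.closure_le]
    rintro w (hw | hw)
    · exact locAtCentre_mono O hA₁T hw
    · exact le_locAtCentre _ O (ht₀T hw)
  apply le_antisymm
  · exact locAtCentre_mono O hTC
  · exact (locAtCentre_mono O hCT).trans (le_of_eq (locAtCentre_locAtCentre _ O))

/-- The pointwise clause of `cleanModels_dimLETwo_of_f75c` at a point, read as `LooseCleanForm` of the pulled-back representative at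
the stalk. [folklore] -/
theorem looseCleanForm_of_pointClause {p : ℕ} {V W : Scheme.{0}} [IsIntegral V] [IsIntegral W] (π : V ⟶ W) [IsDominant π]
    (v : V) (g : W.functionField)
    (h : (∃ (d m : ℕ) (hmd : m ≤ d) (t : Fin d → V.presheaf.stalk v) (a : Fin m → ℕ),
            Ideal.span (Set.range t) = maximalIdeal (V.presheaf.stalk v) ∧
            ringKrullDim (V.presheaf.stalk v) = (d : WithBot ℕ∞) ∧ 0 < m ∧ (∀ i, ¬ p ∣ a i) ∧
            RatFn.functionFieldMap π g = ∏ i : Fin m,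
              (algebraMap (V.presheaf.stalk v) V.functionField (t (Fin.castLE hmd i))) ^ (a i)) ∨
          (∃ u₀ : V.presheaf.stalk v, IsUnit u₀ ∧
            RatFn.functionFieldMap π g = algebraMap (V.presheaf.stalk v) V.functionField u₀ ∧
            ((∀ c : V.presheaf.stalk v, u₀ - c ^ p ∉ maximalIdeal (V.presheaf.stalk v)) ∨
              (∃ c : V.presheaf.stalk v, u₀ - c ^ p ∈ maximalIdeal (V.presheaf.stalk v) ∧
                u₀ - c ^ p ∉ maximalIdeal (V.presheaf.stalk v) ^ 2)))) :
    LooseCleanForm p (algebraMap (V.presheaf.stalk v) V.functionField) (RatFn.functionFieldMap π g) := by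
  rcases h with ⟨d, m, hmd, t, a, hspan, hdim, hm, ha, hG⟩ | ⟨u₀, hu₀, hG, h2 | ⟨c, hc1, hc2⟩⟩
  · refine Or.inl ⟨d, m, hmd, t, a, 1, isUnit_one, hspan, hdim, hm, ha, ?_⟩
    rw [hG, one_mul, map_prod]
    simp only [map_pow]
  · exact Or.inr (Or.inl ⟨u₀, hu₀, hG, h2⟩)
  · exact Or.inr (Or.inr ⟨u₀, c, hG, hc1, hc2⟩)

/-- **Steps 5–9 of `stub_cleanLU2` (D2): clean local uniformization in dimension two from a REGULAR AFFINE model.**  For a finitely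
generated `k`-subalgebra `A₁ ⊆ Ō` of `κ = Frac A₁` which is a regular ring of dimension `≤ 2`, and `ū ∉ κ^p`: some finitely generated
`Ā' ⊇ A₁` inside `Ō` has `locAtCentre Ā' Ō` clean-regular for the `κ^p`-line of `ū` (`CleanRegAt`).  PROOF: ✓ `cleanModels_dimLETwo_of_f75c`
(F-75c = ✓ `stub_stacks0BICLocus`) on `W = Spec A₁` with `L = K(W)(ū^{1/p})` (`AdjoinRoot`), then ✓ `exists_model_of_proper_birational`
(valuative criterion + affine extraction with the stalk / function-field identifications) and transport (`LooseCleanForm.map`,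
`.of_ringEquiv`, ✓ `exists_model_of_isLocalBlowup`). [folklore] -/
theorem cleanRegAt_of_regularAffineModel (p : ℕ) (hp : p.Prime) [CharP k p]
    (Ō : ValuationSubring κ) (A₁ : Subalgebra k κ) (hA₁Ō : A₁.toSubring ≤ Ō.toSubring) (hA₁fg : A₁.FG)
    [IsFractionRing A₁ κ] (hregA₁ : IsRegularRing A₁) (hdimA₁ : ringKrullDim A₁ ≤ 2)
    (ū : κ) (hū : ∀ c : κ, c ^ p ≠ ū) :
    ∃ (Ā' : Subalgebra k κ), Ā'.toSubring ≤ Ō.toSubring ∧ A₁ ≤ Ā' ∧ Ā'.FG ∧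
      CleanRegAt p (locAtCentre Ā'.toSubring Ō).subtype ū := by
  classical
  haveI : Fact p.Prime := ⟨hp⟩
  haveI : CharP κ p := charP_of_injective_algebraMap (algebraMap k κ).injective p
  -- the regular affine model `W = Spec A₁` over `k`
  haveI : Algebra.FiniteType k A₁ := A₁.fg_iff_finiteType.mp hA₁fg
  haveI : IsNoetherianRing A₁ := Algebra.FiniteType.isNoetherianRing k A₁
  haveI : IsDomain (CommRingCat.of A₁) := inferInstanceAs (IsDomain A₁)
  haveI : IsRegularRing (CommRingCat.of A₁) := hregA₁
  let W : Scheme.{0} := Spec (.of A₁)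
  let fW : W ⟶ Spec (.of k) := Spec.map (CommRingCat.ofHom (algebraMap k A₁))
  haveI : IsSeparated fW := inferInstance
  haveI : LocallyOfFiniteType fW := by
    rw [HasRingHomProperty.Spec_iff (P := @LocallyOfFiniteType)]
    exact RingHom.finiteType_algebraMap.mpr inferInstance
  haveI : QuasiCompact fW := inferInstance
  have hWreg : Scheme.IsRegular W := Scheme.isRegular_Spec (.of A₁)
  have hdimW : topologicalKrullDim W ≤ 2 := by
    change topologicalKrullDim (PrimeSpectrum A₁) ≤ 2
    rw [PrimeSpectrum.topologicalKrullDim_eq_ringKrullDim]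
    exact hdimA₁
  -- the function field `F = K(W)` and its embedding `eF : F → κ`
  set F := W.functionField with hF
  haveI hWne : Nonempty (⊤ : W.Opens) := ⟨⟨genericPoint W, trivial⟩⟩
  haveI hfrF : IsFractionRing Γ(W, ⊤) F := functionField_isFractionRing_of_isAffineOpen W ⊤ (isAffineOpen_top W)
  let eΓ : Γ(W, ⊤) ≃+* A₁ := (Scheme.ΓSpecIso (.of A₁)).commRingCatIsoToRingEquiv
  let ιΓ : Γ(W, ⊤) →+* κ := (algebraMap A₁ κ).comp eΓ.toRingHom
  have hιΓ : Function.Injective ιΓ := (IsFractionRing.injective A₁ κ).comp eΓ.injective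
  let eF : F →+* κ := IsFractionRing.lift hιΓ
  have heF : ∀ s : Γ(W, ⊤), eF (algebraMap Γ(W, ⊤) F s) = algebraMap A₁ κ (eΓ s) := fun s =>
    IsFractionRing.lift_algebraMap hιΓ s
  have heFinj : Function.Injective eF := eF.injective
  haveI : CharP F p := eF.charP heFinj p
  haveI : ExpChar F p := ExpChar.prime hp
  -- `ū` read in `F`
  obtain ⟨a, ha⟩ : ∃ a : F, eF a = ū := by
    obtain ⟨n, d, hd, hnd⟩ := IsFractionRing.div_surjective (A := A₁) ū
    refine ⟨algebraMap Γ(W, ⊤) F (eΓ.symm n) / algebraMap Γ(W, ⊤) F (eΓ.symm d), ?_⟩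
    rw [map_div₀, heF, heF, RingEquiv.apply_symm_apply, RingEquiv.apply_symm_apply, hnd]
  have hanot : ∀ b : F, b ^ p ≠ a := fun b hb => hū (eF b) (by rw [← map_pow, hb, ha])
  -- `L = F(ū^{1/p})`
  haveI hirr : Fact (Irreducible (X ^ p - C a : F[X])) := ⟨(X_pow_sub_C_irreducible_iff_of_prime hp).mpr hanot⟩
  let L := AdjoinRoot (X ^ p - C a : F[X])
  haveI : IsPurelyInseparable F L := by
    rw [isPurelyInseparable_iff_pow_mem F p]
    intro x
    obtain ⟨s, hs⟩ := AdjoinRootFrame.exists_pow_eq p a x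
    exact ⟨1, by rw [pow_one]; exact ⟨s, hs⟩⟩
  have hdeg : Module.finrank F L = p := by
    rw [(AdjoinRoot.powerBasis' (AdjoinRootFrame.monic p a)).finrank, AdjoinRootFrame.dim_eq]
  -- the clean model in dimension two
  obtain ⟨V, π, hVint, hπdom, hprop, hbir, hVreg, hpt⟩ :=
    cleanModels_dimLETwo_of_f75c stub_stacks0BICLocus p hp k W fW hWreg L hdeg hdimW
  -- extraction of a finitely generated model at the centre of `Ō`
  have hAO : ∀ z : A₁, algebraMap A₁ κ z ∈ Ō := fun z => hA₁Ō z.2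
  obtain ⟨x, T, hTO, hTfg, δ, Θ, hΘδ, hΘπ⟩ := exists_model_of_proper_birational Ō hAO π hprop hbir
  haveI := hVreg x
  haveI hregR' : IsRegularLocalRing (locAtCentre T.toSubring Ō) := IsRegularLocalRing.of_ringEquiv δ
  -- `Θ ∘ π^♯ = eF`
  have hΘeF : Θ.comp (RatFn.functionFieldMap π) = eF := by
    refine IsLocalization.ringHom_ext (nonZeroDivisors Γ(W, ⊤)) ?_
    ext s
    change Θ (RatFn.functionFieldMap π (algebraMap Γ(W, ⊤) F s)) = eF (algebraMap Γ(W, ⊤) F s)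
    rw [heF]
    exact hΘπ s
  -- the pointwise clause at `x`
  obtain ⟨y, g, hy, hg, hclause⟩ := hpt x
  have hLoose := (looseCleanForm_of_pointClause π x g hclause).map Θ
  have hLoose' : LooseCleanForm p (locAtCentre T.toSubring Ō).subtype (Θ (RatFn.functionFieldMap π g)) :=
    LooseCleanForm.of_ringEquiv δ (f := Θ.comp (algebraMap (V.presheaf.stalk x) V.functionField))
      (f' := (locAtCentre T.toSubring Ō).subtype) (fun r => (hΘδ r).symm) hLoose
  -- the coefficients: `y = Σ y_j θ^j`, `g = Σ y_j^p a^j`, `eF g = Σ (eF y_j)^p ū^j`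
  haveI : CharP L p := charP_of_injective_algebraMap (AdjoinRootFrame.algebraMap_injective p a) p
  let B := (AdjoinRoot.powerBasis' (AdjoinRootFrame.monic p a)).basis
  have hBdim : (AdjoinRoot.powerBasis' (AdjoinRootFrame.monic p a)).dim = p := AdjoinRootFrame.dim_eq p a
  let yc : Fin p → F := fun j => B.repr y (Fin.cast hBdim.symm j)
  have hBapply : ∀ j : Fin p, B (Fin.cast hBdim.symm j) = AdjoinRoot.root (X ^ p - C a : F[X]) ^ (j : ℕ) := by
    intro j
    change (AdjoinRoot.powerBasis' (AdjoinRootFrame.monic p a)).basis (Fin.cast hBdim.symm j) = _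
    rw [PowerBasis.coe_basis, AdjoinRoot.powerBasis'_gen]
    rfl
  have hysum : y = ∑ j : Fin p, yc j • AdjoinRoot.root (X ^ p - C a : F[X]) ^ (j : ℕ) := by
    have h1 := (B.sum_repr y).symm
    rw [← Equiv.sum_comp (finCongr hBdim.symm) (fun i => B.repr y i • B i)] at h1
    simp only [finCongr_apply, hBapply] at h1
    exact h1
  have hgsum : g = ∑ j : Fin p, yc j ^ p * a ^ (j : ℕ) := by
    apply AdjoinRootFrame.algebraMap_injective p a
    haveI : ExpChar L p := ExpChar.prime hp
    rw [hg, hysum, sum_pow_char p, map_sum]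
    refine Finset.sum_congr rfl fun j _ => ?_
    rw [_root_.smul_pow, ← pow_mul, mul_comm (j : ℕ) p, pow_mul, ← AdjoinRootFrame.root_pow p a, Algebra.smul_def,
      map_mul, map_pow, map_pow]
  let c : Fin p → κ := fun j => eF (yc j)
  have hG : Θ (RatFn.functionFieldMap π g) = ∑ j : Fin p, c j ^ p * ū ^ (j : ℕ) := by
    have : Θ (RatFn.functionFieldMap π g) = eF g := by rw [← hΘeF]; rfl
    rw [this, hgsum, map_sum]
    refine Finset.sum_congr rfl fun j _ => ?_
    rw [map_mul, map_pow, map_pow, ha]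
  have hc : ∃ j : Fin p, (j : ℕ) ≠ 0 ∧ c j ≠ 0 := by
    by_contra hcon
    push Not at hcon
    apply hy
    -- all coordinates of index `≠ 0` vanish, so `y = y₀`
    have hyc : ∀ j : Fin p, (j : ℕ) ≠ 0 → yc j = 0 := fun j hj => by
      have := hcon j hj
      exact (map_eq_zero_iff eF heFinj).mp this
    refine ⟨yc ⟨0, hp.pos⟩, ?_⟩
    rw [hysum, Finset.sum_eq_single ⟨0, hp.pos⟩]
    · simp [Algebra.smul_def, AdjoinRoot.algebraMap_eq]
      rfl
    · intro j _ hj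
      rw [hyc j (fun h => hj (Fin.ext h)), zero_smul]
    · intro h; exact absurd (Finset.mem_univ _) h
  have hclean : CleanRegAt p (locAtCentre T.toSubring Ō).subtype ū := ⟨hregR', c, hc, hG ▸ hLoose'⟩
  -- back to a finitely generated `k`-model
  obtain ⟨Ā', hĀ'O, hA₁Ā', hĀ'fg, hR'Ā'⟩ :=
    exists_model_of_isLocalBlowup (le_refl A₁) hA₁fg (isLocalBlowup_locAtCentre_adjoin Ō A₁ hA₁Ō T hTO hTfg)
  refine ⟨Ā', hĀ'O, hA₁Ā', hĀ'fg, ?_⟩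
  rw [← hR'Ā']
  exact hclean

/-- `cleanRegAt_of_regularAffineModel` with the conclusion UNFOLDED to the explicit three-form disjunction of the (C-div) workfile's
`stub_cleanLU2` (so that the stub is this theorem composed with the shrinking of `Ā` to a regular affine model). [folklore] -/
theorem cleanLU2_of_regularAffineModel (p : ℕ) (hp : p.Prime) [CharP k p]
    (Ō : ValuationSubring κ) (A₁ : Subalgebra k κ) (hA₁Ō : A₁.toSubring ≤ Ō.toSubring) (hA₁fg : A₁.FG)
    [IsFractionRing A₁ κ] (hregA₁ : IsRegularRing A₁) (hdimA₁ : ringKrullDim A₁ ≤ 2)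
    (ū : κ) (hū : ∀ c : κ, c ^ p ≠ ū) :
    ∃ (Ā' : Subalgebra k κ), Ā'.toSubring ≤ Ō.toSubring ∧ A₁ ≤ Ā' ∧ Ā'.FG ∧
    ∃ (_ : IsRegularLocalRing (locAtCentre Ā'.toSubring Ō)) (c : Fin p → κ), (∃ j : Fin p, (j : ℕ) ≠ 0 ∧ c j ≠ 0) ∧
    ((∃ (d m : ℕ) (hmd : m ≤ d) (t : Fin d → ↥(locAtCentre Ā'.toSubring Ō)) (a : Fin m → ℕ) (u : ↥(locAtCentre Ā'.toSubring Ō)), IsUnit u ∧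
    Ideal.span (Set.range t) = IsLocalRing.maximalIdeal ↥(locAtCentre Ā'.toSubring Ō) ∧
    ringKrullDim ↥(locAtCentre Ā'.toSubring Ō) = (d : WithBot ℕ∞) ∧ 0 < m ∧ (∀ i, ¬ p ∣ a i) ∧
    (∑ j : Fin p, c j ^ p * ū ^ (j : ℕ)) = (u : κ) * ∏ i : Fin m, ((t (Fin.castLE hmd i) : ↥(locAtCentre Ā'.toSubring Ō)) : κ) ^ (a i)) ∨
    (∃ u : ↥(locAtCentre Ā'.toSubring Ō), IsUnit u ∧ (∑ j : Fin p, c j ^ p * ū ^ (j : ℕ)) = (u : κ) ∧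
    ∀ c' : ↥(locAtCentre Ā'.toSubring Ō), u - c' ^ p ∉ IsLocalRing.maximalIdeal ↥(locAtCentre Ā'.toSubring Ō)) ∨
    (∃ s c' : ↥(locAtCentre Ā'.toSubring Ō), (∑ j : Fin p, c j ^ p * ū ^ (j : ℕ)) = (s : κ) ∧
    s - c' ^ p ∈ IsLocalRing.maximalIdeal ↥(locAtCentre Ā'.toSubring Ō) ∧
    s - c' ^ p ∉ IsLocalRing.maximalIdeal ↥(locAtCentre Ā'.toSubring Ō) ^ 2)) := by
  obtain ⟨Ā', hĀ'O, hA₁Ā', hĀ'fg, hreg, c, hc, hform⟩ :=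
    cleanRegAt_of_regularAffineModel p hp Ō A₁ hA₁Ō hA₁fg hregA₁ hdimA₁ ū hū
  refine ⟨Ā', hĀ'O, hA₁Ā', hĀ'fg, hreg, c, hc, ?_⟩
  rcases hform with ⟨d, m, hmd, t, a, u, hu, hspan, hdim, hm, ha, hX⟩ | ⟨u, hu, hX, hc'⟩ | ⟨s, c', hX, h1, h2⟩
  · refine Or.inl ⟨d, m, hmd, t, a, u, hu, hspan, hdim, hm, ha, ?_⟩
    rw [hX, Subring.subtype_apply]
    push_cast
    rfl
  · exact Or.inr (Or.inl ⟨u, hu, hX, hc'⟩)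
  · exact Or.inr (Or.inr ⟨s, c', hX, h1, h2⟩)

end CleanLU2

end Summit.ResolutionOfSingularities.ResolutionOfSingularities.Theorems.RadicialJung.CleanModels

end
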